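import Literature.RingTheory.HilbertSamuel.RegularLocalRing
import Literature.RingTheory.HilbertSamuel.LocalRing
import Literature.RingTheory.MvPolynomial.LeadingExponents
import Mathlib.LinearAlgebra.FiniteDimensional.Lemmas
import Mathlib.RingTheory.MvPolynomial.Homogeneous
import HarnessLib

/-!
# The symbol map `k[X_1, …, X_e]_d → 𝔪ᵈ/𝔪ᵈ⁺¹` of a local ring and its rank–nullity
# (towards `H^{(0)}_A ∈ HF_e`, CJS Thm. 6.17)

Topic: `Literature/RingTheory/HilbertSamuel`. Cossart–Jannsen–Saito, LNM 2270, §2.2: the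
Hilbert functions of a Noetherian local ring `(A, 𝔪, k)` are "those of the associated graded
ring", `H^{(0)}_A = H(gr_𝔪(A))`, and `gr_𝔪(A)` is a standard graded `k`-algebra generated by the
classes of generators `x_1, …, x_e` of `𝔪`, i.e. a quotient `k[X_1, …, X_e]/J` by a homogeneous
ideal — so `H^{(0)}_A ∈ HF_e` (proof of Thm. 6.17: "all Hilbert–Samuel functions occurring on
the `X_i` are contained in the set `HF_m`"). Mathlib has no associated graded ring; this file
constructs the presentation DEGREE BY DEGREE and proves the dimension count, which is all the
Hilbert function sees:

* `symbolMap x hx d` — the `k`-linear symbol map `(Mon_d →₀ k) → 𝔪ᵈ/𝔪ᵈ⁺¹`,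
  `Σ c̄_m X^m ↦ [Σ c_m x^m]` (well defined: `𝔪`-coefficients land in `𝔪ᵈ⁺¹`), onto
  (`symbolMap_surjective`); `symbolKer` — its kernel `N_d`;
  `finrank_symbolKer_add_hilbertFun` — **`dim_k N_d + H^{(0)}_A(d) = #Mon_d`**.
* (Sequel, `TangentConeIdeal.lean`:) the forms `W_d ⊆ k[X]_d` corresponding to `N_d` satisfy
  `X_l · W_d ⊆ W_{d+1}`, so they span a homogeneous ideal `J` with `J_d = W_d`, whence
  `#Mon_d - dim_k J_d = H^{(0)}_A(d)` and `H^{(0)}_A ∈ HF_e`.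

## Sources

* V. Cossart, U. Jannsen, S. Saito, LNM 2270 (2020), §2.2 (p. 27: `H^{(t)}_𝒪 = H^{(t)}(gr_𝔪(𝒪))`),
  proof of Thm. 6.17 (p. 85). [CossartJannsenSaito2020]
-/

noncomputable section

open IsLocalRing MvPolynomial Finsupp

namespace Literature.RingTheory.HilbertSamuel

open Literature.RingTheory.MvPolynomial

universe u

variable {A : Type u} [CommRing A] [IsLocalRing A] {e : ℕ} (x : Fin e → A)
  (hx : Ideal.span (Set.range x) = maximalIdeal A)

/-! ## The symbol map `(Mon_d →₀ k) → 𝔪ᵈ/𝔪ᵈ⁺¹` -/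

include hx in
/-- Generators of `𝔪` lie in `𝔪` (any local ring; cf. `mem_maximalIdeal_of_rsop` for regular
ones). [folklore] -/
theorem mem_maximalIdeal_of_span_range_eq (i : Fin e) : x i ∈ maximalIdeal A :=
  hx ▸ Ideal.subset_span ⟨i, rfl⟩

/-- The `k`-linear **symbol map** `Σ_m c̄_m X^m ↦ [Σ_m c_m x^m] ∈ 𝔪ᵈ/𝔪ᵈ⁺¹` on the forms of degree
`d` with coefficients in the residue field (on the basis: `X^m ↦ [x^m]`).
[cite: CossartJannsenSaito2020, §2.2 (p. 27)] -/
def symbolMap (hx : Ideal.span (Set.range x) = maximalIdeal A) (d : ℕ) :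
    (monomialsOfDegree e d →₀ ResidueField A) →ₗ[ResidueField A] gradedPiece (maximalIdeal A) d :=
  Finsupp.linearCombination (ResidueField A) fun m =>
    gradedPiece.mk (maximalIdeal A) d
      ⟨∏ i, x i ^ m.1 i, prod_pow_mem_pow x d (mem_maximalIdeal_of_span_range_eq x hx) m⟩

/-- On a basis vector the symbol map is the class of the monomial. [folklore] -/
theorem symbolMap_single (d : ℕ) (m : monomialsOfDegree e d) (a : ResidueField A) :
    symbolMap x hx d (Finsupp.single m a) =
      a • gradedPiece.mk (maximalIdeal A) d
        ⟨∏ i, x i ^ m.1 i, prod_pow_mem_pow x d (mem_maximalIdeal_of_span_range_eq x hx) m⟩ := by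
  rw [symbolMap, Finsupp.linearCombination_single]

/-- Reduction of coefficients `A → k` on coefficient vectors. [folklore] -/
def coeffResidue (d : ℕ) :
    (monomialsOfDegree e d →₀ A) →ₗ[A] (monomialsOfDegree e d →₀ ResidueField A) :=
  Finsupp.mapRange.linearMap (Algebra.linearMap A (ResidueField A))

/-- Unfolding `coeffResidue`. [folklore] -/
theorem coeffResidue_apply (d : ℕ) (c : monomialsOfDegree e d →₀ A) (m : monomialsOfDegree e d) :
    coeffResidue (A := A) d c m = residue A (c m) := rfl

/-- Reduction of coefficients is surjective. [folklore] -/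
theorem coeffResidue_surjective (d : ℕ) : Function.Surjective (coeffResidue (A := A) (e := e) d) :=
  Finsupp.mapRange_surjective _ (map_zero _) residue_surjective

/-- **The symbol map on reduced coefficient vectors is the class of `Σ c_m x^m`.** [folklore] -/
theorem symbolMap_coeffResidue (d : ℕ) (c : monomialsOfDegree e d →₀ A) :
    symbolMap x hx d (coeffResidue d c) =
      gradedPiece.mk (maximalIdeal A) d ⟨evalMonomials x d c,
        evalMonomials_mem_pow x d (mem_maximalIdeal_of_span_range_eq x hx) c⟩ := by
  induction c using Finsupp.induction_linear with
  | zero =>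
    rw [map_zero, map_zero]
    rw [show (⟨evalMonomials x d 0, evalMonomials_mem_pow x d
        (mem_maximalIdeal_of_span_range_eq x hx) 0⟩ : ↥(maximalIdeal A ^ d)) = 0 from
      Subtype.ext (map_zero _), map_zero]
  | add c₁ c₂ h₁ h₂ =>
    rw [map_add, map_add, h₁, h₂, ← map_add]
    congr 1
    exact Subtype.ext (by simp [map_add])
  | single m a =>
    rw [coeffResidue, Finsupp.mapRange.linearMap_apply, Finsupp.mapRange_single, symbolMap_single,
      Algebra.linearMap_apply, algebraMap_smul, ← map_smul]
    congr 1
    apply Subtype.ext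
    simp [evalMonomials, Finsupp.linearCombination_single]

/-- The symbol map is surjective (`𝔪ᵈ` is spanned by the monomials in the generators).
[folklore] -/
theorem symbolMap_surjective (d : ℕ) : Function.Surjective (symbolMap x hx d) := by
  intro q
  obtain ⟨⟨y, hy⟩, rfl⟩ := gradedPiece.mk_surjective (maximalIdeal A) d q
  have hy' : y ∈ Ideal.span (Set.range x) ^ d := by rwa [hx]
  obtain ⟨c, hc⟩ := exists_evalMonomials_eq x d hy'
  refine ⟨coeffResidue d c, ?_⟩
  rw [symbolMap_coeffResidue]
  congr 1
  exact Subtype.ext hc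

/-- Membership of a reduced coefficient vector in the kernel of the symbol map:
`Σ c_m x^m ∈ 𝔪ᵈ⁺¹`. [folklore] -/
theorem coeffResidue_mem_ker_symbolMap_iff (d : ℕ) (c : monomialsOfDegree e d →₀ A) :
    coeffResidue d c ∈ LinearMap.ker (symbolMap x hx d) ↔
      evalMonomials x d c ∈ maximalIdeal A ^ (d + 1) := by
  rw [LinearMap.mem_ker, symbolMap_coeffResidue, gradedPiece.mk_eq_zero_iff]

/-- **`N_d`**: the kernel of the symbol map (the relations of degree `d` among the symbols of the
generators). [cite: CossartJannsenSaito2020, §2.2 (p. 27)] -/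
def symbolKer (hx : Ideal.span (Set.range x) = maximalIdeal A) (d : ℕ) :
    Submodule (ResidueField A) (monomialsOfDegree e d →₀ ResidueField A) :=
  LinearMap.ker (symbolMap x hx d)

/-- **Rank–nullity for the symbol map: `dim_k N_d + H^{(0)}_A(d) = #Mon_d`.**
[cite: CossartJannsenSaito2020, §2.2 (p. 27)] -/
theorem finrank_symbolKer_add_hilbertFun [IsNoetherianRing A] (d : ℕ) :
    Module.finrank (ResidueField A) (symbolKer x hx d) + hilbertFun A d =
      Nat.card (monomialsOfDegree e d) := by
  letI : Fintype (monomialsOfDegree e d) := Fintype.ofFinite _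
  have h := LinearMap.finrank_range_add_finrank_ker (symbolMap x hx d)
  rw [LinearMap.range_eq_top.mpr (symbolMap_surjective x hx d), finrank_top,
    Module.finrank_finsupp_self, ← Nat.card_eq_fintype_card] at h
  rw [symbolKer, hilbertFun, add_comm]
  exact h

end Literature.RingTheory.HilbertSamuel

end
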